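import Summits.Ventures.HSemireg.ObstructionLocusBlockExtDerived

/-!
# Venture HSemireg — (S5) OBSTRUCTION LOCUS away from secant type, XXVII: the DÉVISSAGE of a block model along one
# block — `0 → V^{S∖a₀} → V^S → I_S ∩ V → 0` — and the algebraic inputs of a Künneth-free proof of EXT-NOTE §6.B(b)

HONEST FRAMING.  Part of the Lean side of the computation cell `pub-hsemireg` (track «S4-PUSH» (ii), seat
s4-prove-2; files XXVII–XXIX).  Plain commutative algebra in `R = MvPolynomial (Fin n) K`, every `n`, EVERY
commutative ring `K`; nothing here constructs a variety or a sheaf; nothing here says that HC / HC_CM / HC_AV holds;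
no Literature fact is declared or used; no object is certified.
WHAT FILES XXVII–XXIX ADD.  Files XXV–XXVI proved EXT-NOTE §6.B(b) «`𝓔xt¹(I, I) = 𝓝′` via the connecting map
`δ` of `0 → I → 𝒪 → 𝒪_Z → 0`» with Mathlib's derived `Ext` for SINGLE-block models (`pd_R I_M ≤ 1`), and for a
general block model `M(S_1, …, S_r)` (file XVI; the germ of a (GEN) arrangement at a CROSSING point of `r ≥ 2`
translates, where `pd_R I_M = r`) only the injectivity of `δ`.  The source proves surjectivity there by the tensor
product of the block resolutions + a Künneth formula + a graded count; Mathlib has no Künneth formula.  Files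
XXVII–XXIX prove the surjectivity for EVERY block model by a DÉVISSAGE that needs neither Künneth nor gradings nor
localisation: peel one block `S = S_{i₀}`; with `U = I_S` (the other coordinates free; Hilbert–Burch presentation
`0 → R^{S∖a₀} →Φ R^S → U → 0`, file XXVI) and `V = I_{M'}` the arrangement ideal of the other blocks,
`I_M = U ∩ V = U·V`, and tensoring the presentation with `V` gives a short exact sequence of `R`-modules
`0 → V^{S∖a₀} →Φ_V V^S →E I_M → 0`.  Then (file XXIX) `ι_* : Ext¹_R(I_M, I_M) → Ext¹_R(I_M, R)` vanishes by
induction on the number of blocks: STEP 1 `E^*(ι_*ξ) ∈ Ext¹(V^S, R)` is a sum of classes `ζ_a ∘ [ι_V]`,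
`ζ_a ∈ Ext¹(V, V)`, hence `0` (induction hypothesis); STEP 2 so `ι_*ξ = ∂θ`, `θ ∈ Hom_R(V^{S∖a₀}, R) = R^{S∖a₀}`
(`Hom_R(V, R) = R·ι`, file XVI); STEP 3 `ι_*ξ` dies in `Ext¹(I_M, R/U)` (it factors through `U ↪ R ↠ R/U`), so
`π_U ∘ θ = ψ ∘ Φ_V` with `ψ ∈ Hom_R(V^S, R/U) = (R/U)^S` ((V4) below), whence, testing on `V·e_b` and using
`(U : V) = U` ((V3) below), `θ = ψ₀ ∘ Φ_V + Σ_b u_b·pr_b` with `u_b ∈ U`; STEP 4 `u·pr_b ∈ im Φ^*` for `u ∈ U` by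
the same sequence with `V = R` and `U · Ext¹_R(U, R) = 0` (file XXV), restricted along `V ↪ R`.  Hence
`θ ∈ im Φ_V^*`, `∂θ = 0`, `ι_*ξ = 0`; i.e. `δ` is onto (exactness of `Hom(I, R/I) → Ext¹(I, I) → Ext¹(I, R)`).
THIS FILE (the algebra; no `Ext`):
* `Blocks.restrict B p` (the blocks `S_i`, `p i`), `arrIdeal_eq_blockIdeal_inf_restrict` (**peeling**:
  `I_M = I_{S_{i₀}} ∩ I_{M'}`), `arrIdeal_eq_top_of_isEmpty`, `disjoint_allBlocks_restrict`;
* the inputs on `V = I_{M'}` for blocks missing `S`: **(V2)** `mem_arrIdeal_of_X_mul_mem` (`x_c`, `c` in no block,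
  is a non-zero-divisor mod `I_M`), **(V3)** `mem_blockIdeal_of_forall_mul_mem` (`(I_S : I_{M'}) = I_S`),
  **(V4) `exists_eq_mk_mul_of_hom_to_quot` — `Hom_R(I_{M'}, R/I_S) = (R/I_S)·π̄`** (file XVI's proof of
  `Hom_R(I_M, R) = R·ι` run inside `R/I_S` with file XV's standard parts and «free coordinates divide exactly»);
  (V1) `Hom_R(I_{M'}, R) = R·ι` is file XVI's `exists_eq_mul_of_hom_to_ring`;
* the dévissage maps for a block `S ∋ a₀` and ANY ideal `V`: **`hbMap S a₀ V = Φ_V : V^{S∖a₀} → V^S`**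
  (`Φ_V(w)_a = x_a w_a`, `Φ_V(w)_{a₀} = −x_{a₀} Σ_b w_b`) and **`gsMap S V = E : V^S → I_S ∩ V`**,
  `v ↦ Σ_a x_{S∖a} v_a`; `gsMap_hbMap` (`E ∘ Φ_V = 0`), `hbMap_injective`, **`exact_hbMap_gsMap`** (exact at `V^S`
  when the `x_a`, `a ∈ S`, are non-zero-divisors mod `V` — file XXVI's first syzygies `sum_mul_sq_erase_eq_zero_iff`),
  **`gsMap_surjective`** (onto when `I_S ∩ V ⊆ I_S·V`); and these two hypotheses for `V = I_{M'}`
  (`X_mul_mem_arrIdeal_imp`, `blockIdeal_inf_arrIdeal_restrict_le_mul` — file XVI's `arrIdeal_eq_prod`) and for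
  `V = R` (`X_mul_mem_top_imp`, `blockIdeal_inf_top_le_mul`).
References (dictionary only): EXT-NOTE.md §6.0 (local models), §6.A (block resolutions), §6.B(b); G2-REDUCIBLE-
POINT-THEOREM.md §2 L1 (ii).  The dévissage itself is not taken from a source (standard homological algebra).
-/

open MvPolynomial Finset
open scoped BigOperators

namespace Summit.Ventures.HSemireg.ObstructionLocus.BlockModel

variable {K : Type*} [CommRing K] {n : ℕ} {ι : Type*}

/-! ## Restricting a block structure to some of its blocks -/

/-- The block structure on the blocks `S_i`, `p i` (the other blocks' coordinates become free). -/
def Blocks.restrict (B : Blocks ι n) (p : ι → Prop) : Blocks {i // p i} n where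
  S i := B.S i.1
  disjoint _ _ h := B.disjoint fun h' => h (Subtype.ext h')
  nonempty i := B.nonempty i.1

/-- The blocks of the restriction. -/
@[simp] theorem Blocks.restrict_S (B : Blocks ι n) (p : ι → Prop) (i : {i // p i}) :
    (B.restrict p).S i = B.S i.1 := rfl

/-- Membership in the arrangement ideal of a restriction. -/
theorem mem_arrIdeal_restrict_iff {B : Blocks ι n} {p : ι → Prop} {f : MvPolynomial (Fin n) K} :
    f ∈ arrIdeal K (B.restrict p) ↔ ∀ i, p i → f ∈ blockIdeal K (B.S i) := by
  rw [mem_arrIdeal_iff]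
  exact ⟨fun h i hi => h ⟨i, hi⟩, fun h i => h i.1 i.2⟩

/-- **Peeling one block**: `I_M = I_{S_{i₀}} ∩ I_{M'}`, `M'` the model of the other blocks. -/
theorem arrIdeal_eq_blockIdeal_inf_restrict (B : Blocks ι n) (i₀ : ι) :
    arrIdeal K B = blockIdeal K (B.S i₀) ⊓ arrIdeal K (B.restrict (· ≠ i₀)) := by
  ext f
  rw [Ideal.mem_inf, mem_arrIdeal_iff, mem_arrIdeal_restrict_iff]
  constructor
  · intro h
    exact ⟨h i₀, fun i _ => h i⟩
  · rintro ⟨h₀, h⟩ i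
    by_cases hi : i = i₀
    · subst hi; exact h₀
    · exact h i hi

/-- With no blocks the arrangement ideal is the unit ideal. -/
theorem arrIdeal_eq_top_of_isEmpty [IsEmpty ι] (B : Blocks ι n) : arrIdeal K B = ⊤ := by
  ext f
  simp only [mem_arrIdeal_iff, IsEmpty.forall_iff, Submodule.mem_top]

/-- The other blocks' coordinates miss the peeled block. -/
theorem disjoint_allBlocks_restrict [Fintype ι] [DecidableEq ι] (B : Blocks ι n) (i₀ : ι) :
    Disjoint (B.restrict (· ≠ i₀)).allBlocks (B.S i₀) := by
  rw [Blocks.allBlocks, Finset.disjoint_biUnion_left]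
  intro i _
  exact B.disjoint i.2

/-! ## The algebraic inputs (V2)–(V4) on the ideal `V = I_{M'}` of a block model -/

/-- **(V2)** A coordinate `x_c` in no block is a non-zero-divisor modulo `I_M`: `x_c s ∈ I_M ⟹ s ∈ I_M`. -/
theorem mem_arrIdeal_of_X_mul_mem {B : Blocks ι n} {c : Fin n} (hc : ∀ i, c ∉ B.S i)
    {s : MvPolynomial (Fin n) K} (h : X c * s ∈ arrIdeal K B) : s ∈ arrIdeal K B := by
  classical
  rw [mem_arrIdeal_iff'] at h ⊢
  intro e he i
  have he' : Finsupp.single c 1 + e ∈ (X c * s).support := by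
    rw [support_X_mul, Finset.mem_map]
    exact ⟨e, he, rfl⟩
  exact (blockMem_single_add_iff_of_notMem (hc i) e).1 (h _ he' i)

variable [Fintype ι]

/-- A coordinate off `allBlocks` is in no block. -/
theorem notMem_of_notMem_allBlocks {B : Blocks ι n} {c : Fin n} (hc : c ∉ B.allBlocks) (i : ι) :
    c ∉ B.S i :=
  fun h => hc (Finset.mem_biUnion.2 ⟨i, Finset.mem_univ i, h⟩)

/-- **(V3)** `(I_S : I_M) = I_S` when the blocks of `M` miss `S`: if `d · I_M ⊆ I_S` then `d ∈ I_S` (test on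
`x_{⋃ S_i} ∈ I_M`, a non-zero-divisor on `R/I_S`). -/
theorem mem_blockIdeal_of_forall_mul_mem {B : Blocks ι n} {S : Finset (Fin n)}
    (hS : Disjoint B.allBlocks S) {d : MvPolynomial (Fin n) K}
    (h : ∀ v ∈ arrIdeal K B, d * v ∈ blockIdeal K S) : d ∈ blockIdeal K S := by
  have h1 := h _ (sq_allBlocks_mem B)
  rw [← Ideal.Quotient.eq_zero_iff_mem] at h1 ⊢
  rw [mul_comm, ← smul_mk_eq] at h1
  exact eq_zero_of_sq_smul_eq_zero hS h1

/-- **(V4) `Hom_R(I_M, R/I_S) = (R/I_S)·π̄`** when the blocks of `M` miss `S`: every `R`-linear `ψ : I_M → R/I_S`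
is `v ↦ r v mod I_S` for one polynomial `r` (file XVI's proof of `Hom_R(I_M, R) = R·ι` run in `R/I_S` with file
XV's standard parts: the standard part of `ψ(x_U)`, `U = ⋃ S_i`, is divisible by every `x_c`, `c ∈ U` — «free
coordinates divide exactly» — hence by `x_U`; then cancel `x_U`, a non-zero-divisor on `R/I_S`). -/
theorem exists_eq_mk_mul_of_hom_to_quot (B : Blocks ι n) {S : Finset (Fin n)}
    (hS : Disjoint B.allBlocks S)
    (ψ : ↥(arrIdeal K B) →ₗ[MvPolynomial (Fin n) K] MvPolynomial (Fin n) K ⧸ blockIdeal K S) :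
    ∃ r : MvPolynomial (Fin n) K, ∀ v : ↥(arrIdeal K B),
      ψ v = Ideal.Quotient.mk (blockIdeal K S) (r * v.1) := by
  classical
  set v₀ : ↥(arrIdeal K B) := ⟨sq B.allBlocks, sq_allBlocks_mem B⟩ with hv₀
  obtain ⟨g, hg⟩ := Ideal.Quotient.mk_surjective (ψ v₀)
  have hdiv : ∀ e ∈ (stdPart S g).support, ind B.allBlocks ≤ e := by
    intro e he
    refine ind_le_iff.2 fun c hc => ?_
    have hcS : c ∉ S := Finset.disjoint_left.1 hS hc
    obtain ⟨g', hg'⟩ := Ideal.Quotient.mk_surjective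
      (ψ ⟨sq (B.allBlocks.erase c), sq_allBlocks_erase_mem B c⟩)
    have hfac : v₀ = (X c : MvPolynomial (Fin n) K) •
        (⟨sq (B.allBlocks.erase c), sq_allBlocks_erase_mem B c⟩ : ↥(arrIdeal K B)) := by
      apply Subtype.ext
      change sq B.allBlocks = X c * sq (B.allBlocks.erase c)
      rw [X_mul_sq_erase hc]
    have hgh : Ideal.Quotient.mk (blockIdeal K S) g =
        (X c : MvPolynomial (Fin n) K) • Ideal.Quotient.mk (blockIdeal K S) g' := by
      rw [hg, hfac, map_smul, hg']
    exact Finsupp.mem_support_iff.2 (apply_ne_zero_of_mk_eq_X_smul hcS hgh he)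
  set r : MvPolynomial (Fin n) K := (stdPart S g).divMonomial (ind B.allBlocks) with hr
  have hF : stdPart S g = sq B.allBlocks * r := by rw [hr]; exact eq_sq_mul_divMonomial hdiv
  refine ⟨r, fun v => ?_⟩
  have h1 : (sq B.allBlocks : MvPolynomial (Fin n) K) • v = v.1 • v₀ := by
    apply Subtype.ext
    change sq B.allBlocks * v.1 = v.1 * sq B.allBlocks
    rw [mul_comm]
  have key : (sq B.allBlocks : MvPolynomial (Fin n) K) •
      (ψ v - Ideal.Quotient.mk (blockIdeal K S) (r * v.1)) = 0 := by
    rw [smul_sub, ← map_smul, h1, map_smul, ← hg, ← mk_stdPart S g, hF, smul_mk_eq, smul_mk_eq, sub_eq_zero]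
    congr 1
    ring
  exact sub_eq_zero.1 (eq_zero_of_sq_smul_eq_zero hS key)

/-! ## The dévissage `0 → V^{S ∖ a₀} → V^S → I_S ∩ V → 0` along the Hilbert–Burch presentation of `I_S` -/

section Devissage

/-- Splitting a sum over `↥S` at `a₀ ∈ S`, the rest indexed by `↥(S.erase a₀)`. -/
theorem sum_coe_eq_add_sum_erase {M : Type*} [AddCommMonoid M] {S : Finset (Fin n)} {a₀ : Fin n}
    (ha₀ : a₀ ∈ S) (F : ↥S → M) :
    ∑ a : ↥S, F a = F ⟨a₀, ha₀⟩ + ∑ b : ↥(S.erase a₀), F ⟨b.1, Finset.mem_of_mem_erase b.2⟩ := by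
  classical
  rw [← Finset.add_sum_erase _ _ (Finset.mem_univ (⟨a₀, ha₀⟩ : ↥S))]
  congr 1
  refine Finset.sum_bij' (fun a ha => ⟨a.1, Finset.mem_erase.2 ⟨?_, a.2⟩⟩)
    (fun b _ => ⟨b.1, Finset.mem_of_mem_erase b.2⟩) ?_ ?_ ?_ ?_ ?_
  · intro h
    exact (Finset.mem_erase.1 ha).1 (Subtype.ext h)
  · intro a ha; exact Finset.mem_univ _
  · intro b hb
    exact Finset.mem_erase.2 ⟨fun h => (Finset.mem_erase.1 b.2).1 (congr_arg Subtype.val h), Finset.mem_univ _⟩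
  · intro a ha; rfl
  · intro b hb; rfl
  · intro a ha; rfl

variable (S : Finset (Fin n)) (a₀ : Fin n) (V : Ideal (MvPolynomial (Fin n) K))

/-- **`Φ_V : V^{S ∖ a₀} → V^S`, the Hilbert–Burch matrix of `I_S` acting on `V`**: `Φ_V(w)_a = x_a w_a` for
`a ≠ a₀` and `Φ_V(w)_{a₀} = −x_{a₀} Σ_b w_b` (the syzygies `x_a · x_{S∖a} − x_{a₀} · x_{S∖a₀} = 0`). -/
noncomputable def hbMap :
    (↥(S.erase a₀) → ↥V) →ₗ[MvPolynomial (Fin n) K] (↥S → ↥V) :=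
  LinearMap.pi fun a : ↥S =>
    if h : (a : Fin n) = a₀ then
      -((X a₀ : MvPolynomial (Fin n) K) • ∑ b : ↥(S.erase a₀), LinearMap.proj b)
    else (X (a : Fin n) : MvPolynomial (Fin n) K) •
      LinearMap.proj (⟨a, Finset.mem_erase.2 ⟨h, a.2⟩⟩ : ↥(S.erase a₀))

/-- The `a₀`-component of `Φ_V`. -/
theorem hbMap_apply_of_eq (w : ↥(S.erase a₀) → ↥V) (a : ↥S) (h : (a : Fin n) = a₀) :
    hbMap S a₀ V w a = -((X a₀ : MvPolynomial (Fin n) K) • ∑ b, w b) := by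
  simp [hbMap, h, LinearMap.sum_apply]

/-- The other components of `Φ_V`. -/
theorem hbMap_apply_of_ne (w : ↥(S.erase a₀) → ↥V) (a : ↥S) (h : (a : Fin n) ≠ a₀) :
    hbMap S a₀ V w a =
      (X (a : Fin n) : MvPolynomial (Fin n) K) • w ⟨a, Finset.mem_erase.2 ⟨h, a.2⟩⟩ := by
  simp [hbMap, h]

/-- **`E : V^S → I_S ∩ V`, `v ↦ Σ_a x_{S∖a} v_a`**. -/
noncomputable def gsMap :
    (↥S → ↥V) →ₗ[MvPolynomial (Fin n) K] ↥(blockIdeal K S ⊓ V) :=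
  LinearMap.codRestrict (blockIdeal K S ⊓ V)
    (∑ a : ↥S, (sq (S.erase a.1) : MvPolynomial (Fin n) K) • (V.subtype ∘ₗ LinearMap.proj a)) (by
      intro v
      rw [LinearMap.sum_apply]
      refine Submodule.sum_mem _ fun a _ => ?_
      rw [LinearMap.smul_apply, LinearMap.comp_apply, Submodule.subtype_apply, smul_eq_mul, Ideal.mem_inf]
      exact ⟨Ideal.mul_mem_right _ _ (sq_erase_mem a.2), Ideal.mul_mem_left _ _ (v a).2⟩)

/-- The value of `E`. -/
theorem gsMap_apply_coe (v : ↥S → ↥V) :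
    (gsMap S V v : MvPolynomial (Fin n) K) = ∑ a : ↥S, (v a : MvPolynomial (Fin n) K) * sq (S.erase a.1) := by
  simp [gsMap, LinearMap.sum_apply, smul_eq_mul, mul_comm]

/-- The Hilbert–Burch coefficient vector `s` of `Φ_V(w)`: `Φ_V(w)_a = x_a s_a`, `Σ_a s_a = 0`. -/
noncomputable def hbCoeff (w : ↥(S.erase a₀) → ↥V) (a : ↥S) : MvPolynomial (Fin n) K :=
  if h : (a : Fin n) = a₀ then -∑ b, (w b : MvPolynomial (Fin n) K)
  else (w ⟨a, Finset.mem_erase.2 ⟨h, a.2⟩⟩ : MvPolynomial (Fin n) K)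

/-- `Φ_V(w)_a = x_a s_a`. -/
theorem hbMap_apply_coe (w : ↥(S.erase a₀) → ↥V) (a : ↥S) :
    (hbMap S a₀ V w a : MvPolynomial (Fin n) K) = X (a : Fin n) * hbCoeff S a₀ V w a := by
  by_cases h : (a : Fin n) = a₀
  · rw [hbMap_apply_of_eq S a₀ V w a h, hbCoeff, dif_pos h, h]
    simp [smul_eq_mul]
  · rw [hbMap_apply_of_ne S a₀ V w a h, hbCoeff, dif_neg h]
    simp [smul_eq_mul]

variable {S a₀} in
/-- `Σ_a s_a = 0`. -/
theorem sum_hbCoeff (ha₀ : a₀ ∈ S) (w : ↥(S.erase a₀) → ↥V) : ∑ a, hbCoeff S a₀ V w a = 0 := by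
  rw [sum_coe_eq_add_sum_erase ha₀, hbCoeff, dif_pos rfl]
  have : ∀ b : ↥(S.erase a₀), hbCoeff S a₀ V w ⟨b.1, Finset.mem_of_mem_erase b.2⟩ = (w b : MvPolynomial (Fin n) K) := by
    intro b
    rw [hbCoeff, dif_neg (Finset.mem_erase.1 b.2).1]
  simp only [this, neg_add_cancel]

variable {S a₀} in
/-- `E ∘ Φ_V = 0`. -/
theorem gsMap_hbMap (ha₀ : a₀ ∈ S) (w : ↥(S.erase a₀) → ↥V) : gsMap S V (hbMap S a₀ V w) = 0 := by
  apply Subtype.ext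
  rw [gsMap_apply_coe, Submodule.coe_zero]
  simp only [hbMap_apply_coe]
  exact (sum_mul_sq_erase_eq_zero_iff S _).2 ⟨hbCoeff S a₀ V w, fun a => rfl, sum_hbCoeff V ha₀ w⟩

/-- `Φ_V` is injective (`x_a` is a non-zero-divisor). -/
theorem hbMap_injective : Function.Injective (hbMap (K := K) S a₀ V) := by
  intro w w' h
  funext b
  have hb : (b : Fin n) ≠ a₀ := (Finset.mem_erase.1 b.2).1
  have := congr_fun h ⟨b.1, Finset.mem_of_mem_erase b.2⟩
  rw [hbMap_apply_of_ne S a₀ V w _ hb, hbMap_apply_of_ne S a₀ V w' _ hb] at this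
  have h2 := congr_arg Subtype.val this
  simp only [Submodule.coe_smul, smul_eq_mul] at h2
  exact Subtype.ext (X_mul_cancel_left_iff.1 h2)

variable {S a₀ V} in
/-- **Exactness at `V^S`** when every `x_a`, `a ∈ S`, is a non-zero-divisor modulo `V` (file XXVI's first syzygies):
`E(v) = 0 ⟺ v = Φ_V(w)`. -/
theorem exact_hbMap_gsMap (ha₀ : a₀ ∈ S)
    (hV : ∀ a ∈ S, ∀ s : MvPolynomial (Fin n) K, X a * s ∈ V → s ∈ V) :
    Function.Exact (hbMap S a₀ V) (gsMap S V) := by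
  intro v
  constructor
  · intro hv
    have h0 : ∑ a : ↥S, (v a : MvPolynomial (Fin n) K) * sq (S.erase a.1) = 0 := by
      rw [← gsMap_apply_coe, hv, Submodule.coe_zero]
    obtain ⟨s, hs, hsum⟩ := (sum_mul_sq_erase_eq_zero_iff S _).1 h0
    have hsV : ∀ a, s a ∈ V := fun a => hV a.1 a.2 _ (by rw [← hs a]; exact (v a).2)
    refine ⟨fun b => ⟨s ⟨b.1, Finset.mem_of_mem_erase b.2⟩, hsV _⟩, ?_⟩
    funext a
    apply Subtype.ext
    by_cases h : (a : Fin n) = a₀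
    · rw [hbMap_apply_of_eq S a₀ V _ a h, hs a]
      have ha : a = ⟨a₀, ha₀⟩ := Subtype.ext h
      rw [sum_coe_eq_add_sum_erase ha₀] at hsum
      simp only [Submodule.coe_neg, Submodule.coe_smul, Submodule.coe_sum, smul_eq_mul]
      rw [ha, eq_neg_of_add_eq_zero_left hsum]
      ring
    · rw [hbMap_apply_of_ne S a₀ V _ a h, hs a]
      simp [smul_eq_mul]
  · rintro ⟨w, rfl⟩
    exact gsMap_hbMap V ha₀ w

variable {S V} in
/-- **`E` is onto `I_S ∩ V`** as soon as `I_S ∩ V ⊆ I_S · V`. -/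
theorem gsMap_surjective (hUV : blockIdeal K S ⊓ V ≤ blockIdeal K S * V) :
    Function.Surjective (gsMap (K := K) S V) := by
  classical
  rintro ⟨f, hf⟩
  suffices h : ∀ g ∈ blockIdeal K S * V, ∃ v, (gsMap S V v : MvPolynomial (Fin n) K) = g by
    obtain ⟨v, hv⟩ := h f (hUV hf)
    exact ⟨v, Subtype.ext hv⟩
  intro g hg
  refine Submodule.mul_induction_on hg ?_ ?_
  · intro r hr s hs
    obtain ⟨c, hc⟩ := blockGenMap_surjective S ⟨r, hr⟩
    refine ⟨fun a => c a • ⟨s, hs⟩, ?_⟩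
    have hr' : r = ∑ a : ↥S, c a * sq (S.erase a.1) := by
      rw [← blockGenMap_apply_coe, hc]
    rw [gsMap_apply_coe, hr', Finset.sum_mul]
    refine Finset.sum_congr rfl fun a _ => ?_
    simp only [Submodule.coe_smul, smul_eq_mul]
    ring
  · rintro x y ⟨v, hv⟩ ⟨v', hv'⟩
    exact ⟨v + v', by rw [map_add, Submodule.coe_add, hv, hv']⟩

end Devissage

/-! ## The inputs verified for `V = I_{M'}` and for `V = R` -/

/-- (V2) for the arrangement ideal of blocks missing `S`. -/
theorem X_mul_mem_arrIdeal_imp {B : Blocks ι n} {S : Finset (Fin n)} (hS : Disjoint B.allBlocks S) :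
    ∀ a ∈ S, ∀ s : MvPolynomial (Fin n) K, X a * s ∈ arrIdeal K B → s ∈ arrIdeal K B :=
  fun _ ha _ h => mem_arrIdeal_of_X_mul_mem
    (notMem_of_notMem_allBlocks fun h' => Finset.disjoint_left.1 hS h' ha) h

/-- `I_S ∩ I_{M'} ⊆ I_S · I_{M'}` (both are the arrangement ideal of `M`, file XVI's `arrIdeal_eq_prod`). -/
theorem blockIdeal_inf_arrIdeal_restrict_le_mul [DecidableEq ι] (B : Blocks ι n) (i₀ : ι) :
    blockIdeal K (B.S i₀) ⊓ arrIdeal K (B.restrict (· ≠ i₀)) ≤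
      blockIdeal K (B.S i₀) * arrIdeal K (B.restrict (· ≠ i₀)) := by
  rw [← arrIdeal_eq_blockIdeal_inf_restrict, arrIdeal_eq_prod, arrIdeal_eq_prod,
    ← Finset.mul_prod_erase univ (fun i => blockIdeal K (B.S i)) (Finset.mem_univ i₀)]
  refine le_of_eq ?_
  congr 1
  symm
  refine Finset.prod_bij' (fun i _ => i.1) (fun i hi => ⟨i, (Finset.mem_erase.1 hi).1⟩) ?_ ?_ ?_ ?_ ?_
  · intro i _; exact Finset.mem_erase.2 ⟨i.2, Finset.mem_univ _⟩
  · intro i hi; exact Finset.mem_univ _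
  · intro i _; rfl
  · intro i hi; rfl
  · intro i _; rfl

/-- (V2) for `V = R`. -/
theorem X_mul_mem_top_imp (S : Finset (Fin n)) :
    ∀ a ∈ S, ∀ s : MvPolynomial (Fin n) K, X a * s ∈ (⊤ : Ideal (MvPolynomial (Fin n) K)) →
      s ∈ (⊤ : Ideal (MvPolynomial (Fin n) K)) :=
  fun _ _ _ _ => Submodule.mem_top

/-- `I_S ∩ R ⊆ I_S · R`. -/
theorem blockIdeal_inf_top_le_mul (S : Finset (Fin n)) :
    blockIdeal K S ⊓ ⊤ ≤ blockIdeal K S * ⊤ := by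
  rw [inf_top_eq, Ideal.mul_top]

end Summit.Ventures.HSemireg.ObstructionLocus.BlockModel
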